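import Summits.QuantumFields.YangMills.Theorems.BalabanUVNodesPortS1LZdetAssembly
import Summits.QuantumFields.YangMills.Theorems.BalabanUVNodesPortS1LZdetTwinDefs
import Summits.QuantumFields.YangMills.Theorems.BalabanUVNodesK0RecordFormatNamesP0CGuardedL
import Summits.QuantumFields.YangMills.Theorems.BalabanUVNodesPortS1HalvesJacDefs

/-!
# NODE O port PT-A — THE GLUE OF THE GAUSSIAN SUB-HALF, LETTER LEVEL (27930, line `pta_residueW`): `PowMemberIntTwin F → P0HolExtAtRecordGL F → G3CAtRecordL F → PortRecordLZdetHalf F`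
# (v3.4 letters, ★★★ №565∕№566: the guarded L-edition of the P0-ℂ letter and the repaired G-P6 letter), and the same over the edition-24 letters `P0HolExtAtRecordG` ∕ `G3CAtRecord`

Cell `ym-nodeO-ideate`, porter seat `ymgap-nodeO-port-PTA-1` (gen 8); `--supports stmt-QuantumFields-27930` (helper, P0-free).  [I] = [Balaban1987RG1], [16] = [Balaban1985UV3], [15] = [Balaban1985Variational].
THE QUANTIFIER WALK (◆ CRIT-1 g37's (Q-ord), re-run l.5243∕l.5286): `(c₀, γ₀, γ₁, δ₁)` from the P0 letter · `κt := 4κ₀(64,8) + 2` · the G3C letter ⇒ `δG, Mth'` · `δ₀ := max δG (8κ₀(64,8) + 4)` · the P0 letter ⇒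
`Mth(δ₀)` · `Mth″ := max Mth Mth'` · at `Mc`: the G3C letter ⇒ `Bc` · at `a₀`: the (G-b) guard discharged from ✓`PortRecordLZdetHalf`'s own TokE binder at `ε₁ := min a₁ (a₀∕B₃)` (`B₃ ≥ 2L² > 0`),
the P0 letter ⇒ `α₀ α₁` · at `ε₂₉`: `R := max (2γ₁) (16c₀·64K₀(64,8)·e^{δ₀})`, `E₁ := 2·13·4⁴·(R·Bc + 12(L·Mc)⁴)`, `κ := min κt (δ₀∕2) − 2 ≥ 4κ₀(64,8)` · at `k`: carriers with both conjuncts,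
resolvent pieces, the power member's integer twin, and ✓`lzdetResidue_of_carriers`.
* ★★★ `lzdetHalf_of_twin_GL` — over `P0HolExtAtRecordGL` ∕ `G3CAtRecordL` (the v3.4 signatures).
* ★★ `lzdetHalf_of_twin_G` — over `P0HolExtAtRecordG` ∕ `G3CAtRecord` (edition 24; kept for the record — the same walk without `δ₁`).

HONEST FRAMING.  One `obtain` chain over DISPLAYED letters (inhabited nowhere) and the tree's own assembly; NOTHING of Bałaban's estimates asserted, ported or discharged; `stub_LZdetGlue` is thereby
CLOSED MODULO the registered twin `PowMemberIntTwin` (OPEN, P0-free); `stub_P0C` ∕ `stub_G3C` ∕ `stub_FE` OPEN; 27930 OPEN · no claim; NODE O 0∕1; COUNT 8∕28 · K 1∕4 UNMOVED; finite `𝕋⁴_{L^K}` at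
fixed ε — NOT continuum ∕ OS ∕ Clay; **the Yang–Mills mass gap is NOT proved by any of this.**  No `sorry`, no `def`, no `instance`, no `notation`; standard axioms.
-/

noncomputable section

open scoped BigOperators Matrix.Norms.L2Operator Topology

namespace Summit.QuantumFields.YangMills.Theorems.BalabanUVNodesPortS1

open Summit.QuantumFields.YangMills.Theorems.K0RecordFormatNames
open Literature.MathematicalPhysics.QuantumFieldTheory.Balaban1983to89
open Literature.MathematicalPhysics.QuantumFieldTheory.Balaban1983to89.Node00
open Literature.MathematicalPhysics.QuantumFieldTheory.Balaban1983to89.T4Continuum (T4Family)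
open Literature.MathematicalPhysics.QuantumFieldTheory.Balaban1983to89.B12TreeDecay (K₀ kappa₀)

variable (F : T4Family)

/-- ★★★ **THE GLUE OVER THE v3.4 LETTERS**: the power member's integer twin, the guarded L-edition of the P0-ℂ letter and the repaired G-P6 letter give the Gaussian sub-half `PortRecordLZdetHalf F`.
[cite: Balaban1985UV3, (63) p.272, (23)–(25) p.262; Balaban1987RG1, (2.11)–(2.14) pp.267–268, (1.18)–(1.19) p.263, (1.21) p.264; Balaban1985Variational, Prop. 9 p.309, Thm 1 p.279] -/
theorem lzdetHalf_of_twin_GL (hT : PowMemberIntTwin F) (hP : P0HolExtAtRecordGL F) (hG : G3CAtRecordL F) : PortRecordLZdetHalf F := by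
  obtain ⟨c₀, γ₀, γ₁, δ₁, hc₀, hγ₀, hγ, hδ₁, HP⟩ := hP
  have hγ₁ : 0 < γ₁ := hγ₀.trans_le hγ
  have hκ₈0 : 0 ≤ kappa₀ (4 * 2 ^ 4) (2 * 4) := B12TreeDecay.kappa₀_nonneg (by norm_num) _
  have hκt0 : 0 < 4 * kappa₀ (4 * 2 ^ 4) (2 * 4) + 2 := by positivity
  obtain ⟨δG, hδG, Mth', HG⟩ := hG (4 * kappa₀ (4 * 2 ^ 4) (2 * 4) + 2) hκt0 c₀ γ₀ γ₁ δ₁ hc₀ hγ₀ hγ hδ₁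
  obtain ⟨δ₀, hδ₀G, hδ₀8⟩ : ∃ δ₀ : ℝ, δG ≤ δ₀ ∧ 8 * kappa₀ (4 * 2 ^ 4) (2 * 4) + 4 ≤ δ₀ := ⟨max δG _, le_max_left _ _, le_max_right _ _⟩
  have hδ₀pos : 0 < δ₀ := hδG.trans_le hδ₀G
  obtain ⟨Mth, HM⟩ := HP δ₀ hδ₀pos
  refine ⟨max Mth Mth', fun Mc hMc j c cc₀ c₁ B₃ B₃' a₀ a₁ hGuard _ _ _ hB₃ _ ha₀ ha₁ _ _ hUk hP9 _ ε₂₉ hε => ?_⟩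
  obtain ⟨Bc, hBc, HB⟩ := HG δ₀ hδ₀G Mc ((le_max_right _ _).trans hMc) hGuard
  -- the a₀-guard, discharged from the half's own TokE binder at ε₁ := min a₁ (a₀ ∕ B₃)
  have hB₃pos : 0 < B₃ := by
    have hL : (1 : ℝ) ≤ F.L := by exact_mod_cast F.hL.2.le
    nlinarith
  have hε₁ : 0 < min a₁ (a₀ / B₃) := lt_min ha₁ (div_pos ha₀ hB₃pos)
  have hTokE := hUk (min a₁ (a₀ / B₃)) hε₁ (min_le_left _ _) (by
    calc B₃ * min a₁ (a₀ / B₃) ≤ B₃ * (a₀ / B₃) := mul_le_mul_of_nonneg_left (min_le_right _ _) hB₃pos.le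
      _ = a₀ := by field_simp)
  obtain ⟨α₀, α₁, hα₀, hα₁, HK⟩ := HM Mc ((le_max_left _ _).trans hMc) hGuard a₀ ha₀ ⟨_, hε₁, hTokE⟩
  -- the radius of [16] (63)
  obtain ⟨R, hR₁, hRc⟩ : ∃ R : ℝ, 2 * γ₁ ≤ R ∧ 2 * ((2 * c₀) * (4 * 2 ^ 4 * K₀ (4 * 2 ^ 4) (2 * 4)) * Real.exp δ₀) ≤ R :=
    ⟨max _ _, le_max_left _ _, le_max_right _ _⟩
  have hR : 0 < R := lt_of_lt_of_le (by positivity) hR₁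
  refine ⟨2 * (13 * 4 ^ 4 * (R * Bc + ((3 * 4 * (F.L * Mc) ^ 4 : ℕ) : ℝ))), min (4 * kappa₀ (4 * 2 ^ 4) (2 * 4) + 2) (δ₀ / 2) - 2, α₀, α₁,
    by positivity, ?_, hα₀, hα₁, fun k => ?_⟩
  · have h2 : 4 * kappa₀ (4 * 2 ^ 4) (2 * 4) + 2 ≤ δ₀ / 2 := by
      set κ₈ := kappa₀ (4 * 2 ^ 4) (2 * 4) with hκ₈
      linarith
    have h3 : 4 * kappa₀ (4 * 2 ^ 4) (2 * 4) + 2 ≤ min (4 * kappa₀ (4 * 2 ^ 4) (2 * 4) + 2) (δ₀ / 2) := le_min le_rfl h2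
    set κ₈ := kappa₀ (4 * 2 ^ 4) (2 * 4) with hκ₈
    set m := min (4 * κ₈ + 2) (δ₀ / 2) with hm
    linarith
  · obtain ⟨TC, TY, TZY, AdM, AdZ, hPC, hLat⟩ := HK ε₂₉ hε k
    obtain ⟨EG, EGZ, hG3⟩ := HB a₀ α₀ α₁ ε₂₉ ha₀ hα₀ hα₁ hε k TC TY TZY AdM AdZ hPC hLat
    obtain ⟨ΨP, hΨP⟩ := hT Mc hGuard a₀ δ₀ c₀ γ₀ γ₁ α₀ α₁ ε₂₉ k TC TY TZY AdM AdZ hPC R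
    have hδ : kappa₀ (4 * 2 ^ 4) (2 * 4) ≤ δ₀ / 2 - 1 := by
      set κ₈ := kappa₀ (4 * 2 ^ 4) (2 * 4) with hκ₈
      linarith
    exact lzdetResidue_of_carriers F hGuard k hα₀ hα₁ hc₀ hγ₁ hBc hR hR₁ hδ hRc hε₁ (hTokE k) (fun n => hP9 k n ε₂₉ hε)
      TC TY TZY AdM AdZ hPC EG EGZ hG3 ΨP hΨP

/-- ★★ **THE GLUE OVER THE EDITION-24 LETTERS** (`P0HolExtAtRecordG` ∕ `G3CAtRecord`; the same walk without the lattice rate `δ₁`). [cite: Balaban1985UV3, (63) p.272; Balaban1987RG1, (2.11)–(2.14) pp.267–268, (1.18)–(1.19) p.263, (1.21) p.264; Balaban1985Variational, Prop. 9 p.309] -/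
theorem lzdetHalf_of_twin_G (hT : PowMemberIntTwin F) (hP : P0HolExtAtRecordG F) (hG : G3CAtRecord F) : PortRecordLZdetHalf F := by
  obtain ⟨c₀, γ₀, γ₁, hc₀, hγ₀, hγ, HP⟩ := hP
  have hγ₁ : 0 < γ₁ := hγ₀.trans_le hγ
  have hκ₈0 : 0 ≤ kappa₀ (4 * 2 ^ 4) (2 * 4) := B12TreeDecay.kappa₀_nonneg (by norm_num) _
  have hκt0 : 0 < 4 * kappa₀ (4 * 2 ^ 4) (2 * 4) + 2 := by positivity
  obtain ⟨δG, hδG, Mth', HG⟩ := hG (4 * kappa₀ (4 * 2 ^ 4) (2 * 4) + 2) hκt0 c₀ γ₀ γ₁ hc₀ hγ₀ hγ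
  obtain ⟨δ₀, hδ₀G, hδ₀8⟩ : ∃ δ₀ : ℝ, δG ≤ δ₀ ∧ 8 * kappa₀ (4 * 2 ^ 4) (2 * 4) + 4 ≤ δ₀ := ⟨max δG _, le_max_left _ _, le_max_right _ _⟩
  have hδ₀pos : 0 < δ₀ := hδG.trans_le hδ₀G
  obtain ⟨Mth, HM⟩ := HP δ₀ hδ₀pos
  refine ⟨max Mth Mth', fun Mc hMc j c cc₀ c₁ B₃ B₃' a₀ a₁ hGuard _ _ _ hB₃ _ ha₀ ha₁ _ _ hUk hP9 _ ε₂₉ hε => ?_⟩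
  obtain ⟨Bc, hBc, HB⟩ := HG δ₀ hδ₀G Mc ((le_max_right _ _).trans hMc) hGuard
  have hB₃pos : 0 < B₃ := by
    have hL : (1 : ℝ) ≤ F.L := by exact_mod_cast F.hL.2.le
    nlinarith
  have hε₁ : 0 < min a₁ (a₀ / B₃) := lt_min ha₁ (div_pos ha₀ hB₃pos)
  have hTokE := hUk (min a₁ (a₀ / B₃)) hε₁ (min_le_left _ _) (by
    calc B₃ * min a₁ (a₀ / B₃) ≤ B₃ * (a₀ / B₃) := mul_le_mul_of_nonneg_left (min_le_right _ _) hB₃pos.le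
      _ = a₀ := by field_simp)
  obtain ⟨α₀, α₁, hα₀, hα₁, HK⟩ := HM Mc ((le_max_left _ _).trans hMc) hGuard a₀ ha₀ ⟨_, hε₁, hTokE⟩
  -- the radius of [16] (63)
  obtain ⟨R, hR₁, hRc⟩ : ∃ R : ℝ, 2 * γ₁ ≤ R ∧ 2 * ((2 * c₀) * (4 * 2 ^ 4 * K₀ (4 * 2 ^ 4) (2 * 4)) * Real.exp δ₀) ≤ R :=
    ⟨max _ _, le_max_left _ _, le_max_right _ _⟩
  have hR : 0 < R := lt_of_lt_of_le (by positivity) hR₁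
  refine ⟨2 * (13 * 4 ^ 4 * (R * Bc + ((3 * 4 * (F.L * Mc) ^ 4 : ℕ) : ℝ))), min (4 * kappa₀ (4 * 2 ^ 4) (2 * 4) + 2) (δ₀ / 2) - 2, α₀, α₁,
    by positivity, ?_, hα₀, hα₁, fun k => ?_⟩
  · have h2 : 4 * kappa₀ (4 * 2 ^ 4) (2 * 4) + 2 ≤ δ₀ / 2 := by
      set κ₈ := kappa₀ (4 * 2 ^ 4) (2 * 4) with hκ₈
      linarith
    have h3 : 4 * kappa₀ (4 * 2 ^ 4) (2 * 4) + 2 ≤ min (4 * kappa₀ (4 * 2 ^ 4) (2 * 4) + 2) (δ₀ / 2) := le_min le_rfl h2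
    set κ₈ := kappa₀ (4 * 2 ^ 4) (2 * 4) with hκ₈
    set m := min (4 * κ₈ + 2) (δ₀ / 2) with hm
    linarith
  · obtain ⟨TC, TY, TZY, AdM, AdZ, hPC⟩ := HK ε₂₉ hε k
    obtain ⟨EG, EGZ, hG3⟩ := HB a₀ α₀ α₁ ε₂₉ ha₀ hα₀ hα₁ hε k TC TY TZY AdM AdZ hPC
    obtain ⟨ΨP, hΨP⟩ := hT Mc hGuard a₀ δ₀ c₀ γ₀ γ₁ α₀ α₁ ε₂₉ k TC TY TZY AdM AdZ hPC R
    have hδ : kappa₀ (4 * 2 ^ 4) (2 * 4) ≤ δ₀ / 2 - 1 := by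
      set κ₈ := kappa₀ (4 * 2 ^ 4) (2 * 4) with hκ₈
      linarith
    exact lzdetResidue_of_carriers F hGuard k hα₀ hα₁ hc₀ hγ₁ hBc hR hR₁ hδ hRc hε₁ (hTokE k) (fun n => hP9 k n ε₂₉ hε)
      TC TY TZY AdM AdZ hPC EG EGZ hG3 ΨP hΨP

end Summit.QuantumFields.YangMills.Theorems.BalabanUVNodesPortS1

end
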